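import Summits.KontsevichZagierPeriods.KontsevichZagierPeriods.Theses.LiouvilleUnfolding
import Summits.KontsevichZagierPeriods.KontsevichZagierPeriods.Theorems.LiouvilleUnfoldingLogKernelConjectureIffSummit
import Summits.KontsevichZagierPeriods.KontsevichZagierPeriods.Theorems.LiouvilleUnfoldingLogKernelConjectureStubSplit
import Summits.KontsevichZagierPeriods.KontsevichZagierPeriods.Theorems.LogKernelConjecture.Negative.Sandwich
import Summits.KontsevichZagierPeriods.KontsevichZagierPeriods.Theorems.BetaCancellation.Negative.PiLink
import Summits.KontsevichZagierPeriods.KontsevichZagierPeriods.Theorems.AyoubSpecialisationAssembly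
import Literature.NumberTheory.Transcendental.KZKernelConjectureForms
import Literature.NumberTheory.Transcendental.KZLogCalculusProofs

/-!
# Census of the crux `LiouvilleUnfolding.LogKernelConjecture` (stmt-KontsevichZagierPeriods-2837), part 2

Problem `KontsevichZagierPeriods`, route `LiouvilleUnfolding`, line `spectator-localisation` (lead,
continuation seat c1). Part 1 (`LiouvilleUnfoldingLogKernelConjectureIffSummit.lean`) proved
`LogKernelConjecture ↔ KZKernelConjecture ↔ KontsevichZagierPeriods` now that the sibling crux
`LogPrimitiveNL` (stmt-2836) is a theorem. This file completes the census:

* `logClosure_eq_relations` — the five-rule relation group `logClosure` of Negative/Sandwich §1 (closure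
  of `KZ.relations ∪ logNLInstances`) IS `KZ.relations`; so the crux reads `ker KZ.eval ≤ KZ.relations`
  on the nose (`logKernelConjecture_iff_ker_le_relations`);
* `logKernelConjecture_iff_pair`, `logKernelConjecture_iff_kzlogKernelConjecture` — the semialgebraic
  two-representation form `KZPeriodConjecture'` and the kernel conjecture of the SYNTACTIC nine-move
  logarithmic calculus `KZlog` are further equivalent forms;
* `logKernelConjecture_iff_darkTorsion_and_spectatorFibration` — by the landed exact split of the line
  (`SpectatorLocalisation.stub_split`, p87631; its engine `FibredSpectatorCancellation₁` is a theorem) the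
  crux is equivalent to the conjunction of the line's two registered open stubs
  `stub_darkTorsion ∧ stub_spectatorFibration` (one-dimensional spectators `s` with `s.value ≠ 0`); so is
  the summit (`summit_iff_darkTorsion_and_spectatorFibration`);
* POSITION OF EACH STUB against the `π`-localisation pair of route AyoubSpecialisation
  (`KZ.PiLocalKernel`, `KZ.PiCancellation`, open conjectures in `KZProduct.lean`):
  `darkTorsion₁_of_piLocalKernel : KZ.PiLocalKernel → stub_darkTorsion` (the arithmetic stub is AT MOST
  as strong as the `π`-local kernel) and `piCancellation_of_spectatorFibration₁ :
  stub_spectatorFibration → KZ.PiCancellation` (the structural stub is AT LEAST as strong as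
  `π`-cancellation), while both pairs conjoin to the same statement
  (`darkTorsion_and_spectatorFibration_iff_piLocalKernel_and_piCancellation`).

All statements are unconditional. References: M. Kontsevich, D. Zagier, *Periods* (2001), §1.2
Conjecture 1, §4.1; J. Ayoub, *Periods and the conjectures of Grothendieck and Kontsevich–Zagier*, EMS
Newsl. 91 (2014), Conj. 7; A. Huber, S. Müller-Stach, *Periods and Nori Motives* (2017), Conj. 13.2.1.
-/

noncomputable section

open Literature.NumberTheory.Transcendental

namespace Summit.KontsevichZagierPeriods.LiouvilleUnfolding.LogKernelConjectureCensus

open Summit.KontsevichZagierPeriods.KontsevichZagierPeriods.Theses.LiouvilleUnfolding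
  (LogKernelConjecture LogPrimitiveNL)
open Summit.KontsevichZagierPeriods.KontsevichZagierPeriods.BetaCancellationNegative (betaHalfRep
  equivalent_betaHalfRep_piRep betaHalfRep_value)

/-! ## The crux as an inclusion of subgroups -/

/-- **The five-rule relation group IS the four-rule one**: `logClosure = KZ.relations`, because every
logarithmic Newton–Leibniz instance is already a four-rule relation (`LogPrimitiveNL_of`, stmt-2836).
[folklore] -/
theorem logClosure_eq_relations : LogKernelConjectureNegative.logClosure = KZ.relations :=
  LogKernelConjectureNegative.logPrimitiveNL_iff_logClosure_eq.1 LogPrimitiveNL.LogPrimitiveNL_of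

/-- The crux as an inclusion of subgroups of the formal group: `LogKernelConjecture ↔ ker KZ.eval ≤
KZ.relations` (soundness gives the reverse inclusion, so this is `ker eval = relations`). [folklore] -/
theorem logKernelConjecture_iff_ker_le_relations : LogKernelConjecture ↔ KZ.eval.ker ≤ KZ.relations := by
  rw [LogKernelConjectureNegative.logKernelConjecture_iff_ker_le, logClosure_eq_relations]

/-- The crux alone closes the route: `LogKernelConjecture → KontsevichZagierPeriods` (the route's
deciding theorem `closes h₁ h₂` with `h₁ := LogPrimitiveNL_of` discharged). [folklore] -/
theorem summit_of_logKernelConjecture (h : LogKernelConjecture) : KontsevichZagierPeriods :=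
  SpectatorLocalisation.logKernelConjecture_iff_summit.1 h

/-! ## Two more equivalent forms -/

/-- **Semialgebraic pair form.** The crux is equivalent to `KZPeriodConjecture'`: any two integral
representations (semialgebraic data, any dimensions) with the same value are `KZ.Equivalent`.
[folklore] -/
theorem logKernelConjecture_iff_pair : LogKernelConjecture ↔ KZPeriodConjecture' :=
  SpectatorLocalisation.logKernelConjecture_iff_kzKernelConjecture.trans
    kzKernelConjecture_iff_kzPeriodConjecture'

/-- **Syntactic form.** The crux is equivalent to the kernel conjecture of the SYNTACTIC logarithmic
calculus `KZlog` (nine moves on terms `h₀ + Σ hᵢ log vᵢ`; its conservativity over the four rules is the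
tree theorem `KZlog.Conservative_holds`). [folklore] -/
theorem logKernelConjecture_iff_kzlogKernelConjecture : LogKernelConjecture ↔ KZlog.KernelConjecture :=
  SpectatorLocalisation.logKernelConjecture_iff_kzKernelConjecture.trans
    KZlog.kzKernelConjecture_iff_kernelConjecture

/-! ## Position of the line `spectator-localisation`: the crux is the conjunction of its two open stubs -/

/-- **Census — the crux in the line's vocabulary.** `LogKernelConjecture ↔ stub_darkTorsion ∧
stub_spectatorFibration` (statements inlined verbatim as registered): part 1 of the census composed
with the landed exact split `SpectatorLocalisation.stub_split` (p87631). So each open stub is implied by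
the crux (= the summit) and the two together are the crux. [folklore] -/
theorem logKernelConjecture_iff_darkTorsion_and_spectatorFibration :
    Summit.KontsevichZagierPeriods.KontsevichZagierPeriods.Theses.LiouvilleUnfolding.LogKernelConjecture ↔
      ((∀ c : Literature.NumberTheory.Transcendental.KZ.FormalRep,
          Literature.NumberTheory.Transcendental.KZ.eval c = 0 →
            ∃ l : List (Literature.NumberTheory.Transcendental.KZ.IntegralRep 1),
              (∀ s ∈ l, s.value ≠ 0) ∧
                List.foldr (fun s x => Literature.NumberTheory.Transcendental.KZ.of s * x) c l ∈
                  Literature.NumberTheory.Transcendental.KZ.relations) ∧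
        (∀ (s : Literature.NumberTheory.Transcendental.KZ.IntegralRep 1)
          (c : Literature.NumberTheory.Transcendental.KZ.FormalRep), s.value ≠ 0 →
            Literature.NumberTheory.Transcendental.KZ.of s * c ∈
              Literature.NumberTheory.Transcendental.KZ.relations →
              ∃ c' : Literature.NumberTheory.Transcendental.KZ.FormalRep,
                c - c' ∈ Literature.NumberTheory.Transcendental.KZ.relations ∧
                  Literature.NumberTheory.Transcendental.KZ.of s * c' ∈
                    Literature.NumberTheory.Transcendental.KZ.fibredRelations)) :=
  SpectatorLocalisation.logKernelConjecture_iff_kzKernelConjecture.trans SpectatorLocalisation.stub_split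

/-- **The summit in the line's vocabulary**: `KontsevichZagierPeriods ↔ DarkTorsion₁ ∧
SpectatorFibration₁` (the two registered stubs, inlined). [folklore] -/
theorem summit_iff_darkTorsion_and_spectatorFibration :
    KontsevichZagierPeriods ↔
      ((∀ c : KZ.FormalRep, KZ.eval c = 0 → ∃ l : List (KZ.IntegralRep 1), (∀ s ∈ l, s.value ≠ 0) ∧
        List.foldr (fun s x => KZ.of s * x) c l ∈ KZ.relations) ∧
      (∀ (s : KZ.IntegralRep 1) (c : KZ.FormalRep), s.value ≠ 0 → KZ.of s * c ∈ KZ.relations →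
        ∃ c' : KZ.FormalRep, c - c' ∈ KZ.relations ∧ KZ.of s * c' ∈ KZ.fibredRelations)) :=
  SpectatorLocalisation.logKernelConjecture_iff_summit.symm.trans
    logKernelConjecture_iff_darkTorsion_and_spectatorFibration

/-! ## Position of each stub against the `π`-localisation pair (`KZ.PiLocalKernel`, `KZ.PiCancellation`) -/

/-- **The arithmetic stub is at most as strong as the `π`-local kernel**:
`KZ.PiLocalKernel → DarkTorsion₁`, replacing each disc `[π]` by the one-dimensional representative
`[β(½,½)] ∼ [π]` (`BetaCancellationNegative.equivalent_betaHalfRep_piRep`; landed general form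
`SpectatorLocalisation.stub_split_darkTorsion_of_piLocalKernel`). [folklore] -/
theorem darkTorsion₁_of_piLocalKernel (h : KZ.PiLocalKernel) :
    (∀ c : KZ.FormalRep, KZ.eval c = 0 → ∃ l : List (KZ.IntegralRep 1), (∀ s ∈ l, s.value ≠ 0) ∧
        List.foldr (fun s x => KZ.of s * x) c l ∈ KZ.relations) :=
  SpectatorLocalisation.stub_split_darkTorsion_of_piLocalKernel betaHalfRep equivalent_betaHalfRep_piRep h

/-- **The structural stub is at least as strong as `π`-cancellation**:
`SpectatorFibration₁ → KZ.PiCancellation`. From `[π]·c ∈ relations` pass to `[β(½,½)]·c ∈ relations`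
(products respect relations, `KZ.mul_sub_mul_mem_relations`), then cancel the one-dimensional spectator
`[β(½,½)]` of value `π ≠ 0` (`SpectatorLocalisation.stub_split_cancellation_of_spectatorFibration`, i.e.
fibration + the landed engine). [folklore] -/
theorem piCancellation_of_spectatorFibration₁
    (h : (∀ (s : KZ.IntegralRep 1) (c : KZ.FormalRep), s.value ≠ 0 → KZ.of s * c ∈ KZ.relations →
        ∃ c' : KZ.FormalRep, c - c' ∈ KZ.relations ∧ KZ.of s * c' ∈ KZ.fibredRelations)) :
    KZ.PiCancellation := by
  intro c hc
  have hβπ : KZ.of betaHalfRep - KZ.of KZ.piRep ∈ KZ.relations := equivalent_betaHalfRep_piRep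
  have h1 : KZ.of betaHalfRep * c - KZ.of KZ.piRep * c ∈ KZ.relations :=
    KZ.mul_sub_mul_mem_relations hβπ (by simp [KZ.relations.zero_mem])
  have h2 : KZ.of betaHalfRep * c ∈ KZ.relations := by
    have := KZ.relations.add_mem h1 hc
    simpa using this
  have hval : betaHalfRep.value ≠ 0 := by
    rw [betaHalfRep_value]
    exact Real.pi_ne_zero
  exact SpectatorLocalisation.stub_split_cancellation_of_spectatorFibration h betaHalfRep c hval h2

/-- **Both pairs conjoin to the summit.** `DarkTorsion₁ ∧ SpectatorFibration₁ ↔ KZ.PiLocalKernel ∧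
KZ.PiCancellation` — each side is equivalent to `KZKernelConjecture` (the line's exact split, resp. the
`π`-localisation assembly `AyoubSpecialisation.kzKernelConjecture_of_piLocalKernel_of_piCancellation` and
`KZ.piLocalKernel_and_piCancellation_of_kernel`). Within the pairs the strengths cross:
`DarkTorsion₁ ≤ PiLocalKernel` and `SpectatorFibration₁ ≥ PiCancellation`. [folklore] -/
theorem darkTorsion_and_spectatorFibration_iff_piLocalKernel_and_piCancellation :
    ((∀ c : KZ.FormalRep, KZ.eval c = 0 → ∃ l : List (KZ.IntegralRep 1), (∀ s ∈ l, s.value ≠ 0) ∧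
        List.foldr (fun s x => KZ.of s * x) c l ∈ KZ.relations) ∧
      (∀ (s : KZ.IntegralRep 1) (c : KZ.FormalRep), s.value ≠ 0 → KZ.of s * c ∈ KZ.relations →
        ∃ c' : KZ.FormalRep, c - c' ∈ KZ.relations ∧ KZ.of s * c' ∈ KZ.fibredRelations)) ↔
      (KZ.PiLocalKernel ∧ KZ.PiCancellation) := by
  rw [← SpectatorLocalisation.stub_split]
  constructor
  · intro hK
    exact KZ.piLocalKernel_and_piCancellation_of_kernel KZ.relations_le_ker_eval_holds hK
  · rintro ⟨hL, hC⟩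
    refine AyoubSpecialisation.kzKernelConjecture_of_piLocalKernel_of_piCancellation
      KZ.FormalRep.mul (KZ.of KZ.piRep) (fun c hc => ?_) (fun c hc => hC c ?_)
    · obtain ⟨N, hN⟩ := hL c hc
      exact ⟨N, by simpa [KZ.FormalRep.mul] using hN⟩
    · simpa [KZ.FormalRep.mul] using hc

end Summit.KontsevichZagierPeriods.LiouvilleUnfolding.LogKernelConjectureCensus

end
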